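import Summits.PneNP.PneNP.Theorems.ChebyshevTracialDesignBlockEdgeSwaps
import HarnessLib

/-!
# Cell pnp-psdrank, route `ChebyshevTracialDesign`: EXCHANGEABILITY of the block edges, III — every JUNTA statistic of the in-set
# `U ∩ H` has the shell average of its symmetrisation, a univariate mask of `|U ∩ H|` (brick 157c; crux `TracialDecayExp20`,
# stmt-PneNP-19878)

Brick 157c (prover g31; MEMO-34 §4(b)). Setting of brick 157a (`…BlockEdgeSwaps`): a partner involution `π`, a `π`-stable ground set `S`, a
block `H` with no edge of `S` inside. Brick 157a says that the in-set fibre count `#{U ∈ Shell_S(t,c) : U ∩ H = I}` depends on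
`I ⊆ S ∩ H` only through `|I|`; brick 157b drew the consequence for the traces on two sub-blocks. This file records the GENERAL consequence,
the natural primitive for junta masks (`k` sub-blocks, singletons, …):

* **`sum_shellIn_inset_eq_sum_symm`** — for EVERY function `f` of the in-set,
  `Σ_{U ∈ Shell_S(t,c)} f(U ∩ H) = Σ_{U ∈ Shell_S(t,c)} f̄(|U ∩ H|)` with the symmetrisation
  `f̄(x) = (Σ_{I ⊆ S∩H, |I| = x} f(I)) / C(|S∩H|, x)` (the average of `f` over the `x`-subsets of the block vertices of `S`; spelled out, no
  definition is introduced): conditionally on `|U ∩ H| = x` the in-set is a UNIFORM `x`-subset of `S ∩ H`, at every level and cut size;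
* `shellInAvg_inset_eq` (average form), `abs_symm_le` (`|f̄| ≤ G` if `|f| ≤ G` on the subsets of `S ∩ H`), `symm_nonneg`.
So every univariate small-block tool of the cell prices every junta mask of the in-set of a block without internal edges (after the class split
of the internal edges, bricks 152a/159a). WHAT THIS FILE DOES NOT DO: anything quantitative; anything on `TracialDecayExp20` itself, psd rank
of P_PM(K_n), or P vs NP. [cite: Rothvoss2017, §2 (PDF pp. 5–6)] [cite: GodsilMeagher2015, §15.2]
Stature: support/instrument (kernel lane, no defs, axioms standard). Supports stmt-PneNP-19878.
-/

set_option linter.dupNamespace false -- `Summit.PneNP.PneNP.…`: summit = sub-problem (D-0017)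

noncomputable section

namespace Summit.PneNP.PneNP.Theorems.ChebyshevTracialDesignInSetSymmetrization

open Finset Literature.Combinatorics.Optimization Literature.Combinatorics.Optimization.ShellStep
open Summit.PneNP.PneNP.Theorems.ChebyshevTracialDesignBlockEdgeSwaps (card_filter_inter_eq_eq_of_card_eq)

variable {n : ℕ} {π : Fin n → Fin n} (hπ : ∀ v, π (π v) = v) (hπ' : ∀ v, π v ≠ v)

omit hπ hπ' in
/-- A shell sum of a function of the in-set, sorted by the in-set: `Σ_{U ∈ Shell} g(U ∩ H) = Σ_{I ⊆ S∩H} #{U : U ∩ H = I}·g(I)`.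
[cite: Rothvoss2017, §2 (PDF p. 6)] -/
theorem sum_shellIn_eq_sum_fibre {S H : Finset (Fin n)} (t c : ℕ) (g : Finset (Fin n) → ℝ) :
    ∑ U ∈ shellIn π S t c, g (U ∩ H) =
      ∑ I ∈ (S ∩ H).powerset, (((shellIn π S t c).filter fun U => U ∩ H = I).card : ℝ) * g I := by
  classical
  have hmaps : ∀ U ∈ shellIn π S t c, U ∩ H ∈ (S ∩ H).powerset := fun U hU =>
    mem_powerset.2 (inter_subset_inter_right (mem_shellIn.1 hU).1)
  rw [← sum_fiberwise_of_maps_to hmaps]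
  refine sum_congr rfl fun I _ => ?_
  rw [sum_congr rfl fun U hU => by rw [(mem_filter.1 hU).2], sum_const, nsmul_eq_mul]

include hπ hπ' in
/-- **Every junta statistic of the in-set has the shell average of its symmetrisation.** `S` stable, `H` without an edge of `S` inside;
for every `f`: `Σ_{U ∈ Shell_S(t,c)} f(U ∩ H) = Σ_{U ∈ Shell_S(t,c)} f̄(|U ∩ H|)`, `f̄(x) = (Σ_{I ⊆ S∩H, |I|=x} f(I)) / C(|S∩H|, x)`.
[cite: Rothvoss2017, §2 (PDF p. 6)] [cite: GodsilMeagher2015, §15.2] -/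
theorem sum_shellIn_inset_eq_sum_symm {S H : Finset (Fin n)} (hS : ∀ v ∈ S, π v ∈ S) (hno : ∀ v ∈ S, ¬ (v ∈ H ∧ π v ∈ H))
    (t c : ℕ) (f : Finset (Fin n) → ℝ) :
    ∑ U ∈ shellIn π S t c, f (U ∩ H) =
      ∑ U ∈ shellIn π S t c, (∑ I ∈ (S ∩ H).powersetCard (U ∩ H).card, f I) / (((S ∩ H).card.choose (U ∩ H).card : ℕ) : ℝ) := by
  classical
  -- both sides sorted by the in-set
  have hR : ∑ U ∈ shellIn π S t c, (∑ I ∈ (S ∩ H).powersetCard (U ∩ H).card, f I) / (((S ∩ H).card.choose (U ∩ H).card : ℕ) : ℝ) =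
      ∑ U ∈ shellIn π S t c, (fun J : Finset (Fin n) =>
        (∑ I ∈ (S ∩ H).powersetCard J.card, f I) / (((S ∩ H).card.choose J.card : ℕ) : ℝ)) (U ∩ H) := rfl
  rw [hR, sum_shellIn_eq_sum_fibre t c f,
    sum_shellIn_eq_sum_fibre t c (fun J : Finset (Fin n) =>
      (∑ I ∈ (S ∩ H).powersetCard J.card, f I) / (((S ∩ H).card.choose J.card : ℕ) : ℝ))]
  -- group the subsets of `S ∩ H` by size
  rw [← sum_fiberwise_of_maps_to (s := (S ∩ H).powerset) (t := range ((S ∩ H).card + 1)) (g := fun I => I.card)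
    (fun I hI => mem_range.2 (Nat.lt_succ_of_le (card_le_card (mem_powerset.1 hI)))),
    ← sum_fiberwise_of_maps_to (s := (S ∩ H).powerset) (t := range ((S ∩ H).card + 1)) (g := fun I => I.card)
    (fun I hI => mem_range.2 (Nat.lt_succ_of_le (card_le_card (mem_powerset.1 hI))))]
  refine sum_congr rfl fun x hx => ?_
  have hpc : ((S ∩ H).powerset.filter fun I => I.card = x) = (S ∩ H).powersetCard x := by
    rw [powersetCard_eq_filter]
  rw [hpc]
  -- the fibre count is constant on the size class
  rcases ((S ∩ H).powersetCard x).eq_empty_or_nonempty with h0 | ⟨I₀, hI₀⟩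
  · rw [h0, sum_empty, sum_empty]
  have hI₀' := mem_powersetCard.1 hI₀
  set N₀ : ℝ := (((shellIn π S t c).filter fun U => U ∩ H = I₀).card : ℝ) with hN₀
  have hconst : ∀ I ∈ (S ∩ H).powersetCard x, (((shellIn π S t c).filter fun U => U ∩ H = I).card : ℝ) = N₀ := by
    intro I hI
    obtain ⟨hIS, hIc⟩ := mem_powersetCard.1 hI
    rw [hN₀]
    exact_mod_cast card_filter_inter_eq_eq_of_card_eq hπ hπ' hS hno t c hIS hI₀'.1 (hIc.trans hI₀'.2.symm)
  have hpos : (0 : ℝ) < (((S ∩ H).card.choose x : ℕ) : ℝ) := by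
    have hx : x ≤ (S ∩ H).card := hI₀'.2 ▸ card_le_card hI₀'.1
    exact_mod_cast Nat.choose_pos hx
  calc ∑ I ∈ (S ∩ H).powersetCard x, (((shellIn π S t c).filter fun U => U ∩ H = I).card : ℝ) * f I
      = ∑ I ∈ (S ∩ H).powersetCard x, N₀ * f I := sum_congr rfl fun I hI => by rw [hconst I hI]
    _ = N₀ * ∑ I ∈ (S ∩ H).powersetCard x, f I := by rw [mul_sum]
    _ = ∑ I ∈ (S ∩ H).powersetCard x, N₀ * ((∑ J ∈ (S ∩ H).powersetCard x, f J) / (((S ∩ H).card.choose x : ℕ) : ℝ)) := by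
        rw [sum_const, card_powersetCard, nsmul_eq_mul]
        field_simp
    _ = ∑ I ∈ (S ∩ H).powersetCard x, (((shellIn π S t c).filter fun U => U ∩ H = I).card : ℝ) *
          ((∑ J ∈ (S ∩ H).powersetCard I.card, f J) / (((S ∩ H).card.choose I.card : ℕ) : ℝ)) :=
        sum_congr rfl fun I hI => by rw [hconst I hI, (mem_powersetCard.1 hI).2]

include hπ hπ' in
/-- **Average form**: `E_{Shell_S(t,c)}[f(U ∩ H)] = E_{Shell_S(t,c)}[f̄(|U ∩ H|)]`. [cite: Rothvoss2017, §2 (PDF p. 6)] -/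
theorem shellInAvg_inset_eq {S H : Finset (Fin n)} (hS : ∀ v ∈ S, π v ∈ S) (hno : ∀ v ∈ S, ¬ (v ∈ H ∧ π v ∈ H))
    (t c : ℕ) (f : Finset (Fin n) → ℝ) :
    (∑ U ∈ shellIn π S t c, f (U ∩ H)) / ((shellIn π S t c).card : ℝ) =
      (∑ U ∈ shellIn π S t c, (∑ I ∈ (S ∩ H).powersetCard (U ∩ H).card, f I) /
        (((S ∩ H).card.choose (U ∩ H).card : ℕ) : ℝ)) / ((shellIn π S t c).card : ℝ) := by
  rw [sum_shellIn_inset_eq_sum_symm hπ hπ' hS hno t c f]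

omit hπ hπ' in
/-- **The symmetrisation of a bounded statistic is bounded**: `|f̄(x)| ≤ G` if `|f| ≤ G` on the subsets of `S ∩ H`. [folklore] -/
theorem abs_symm_le {B : Finset (Fin n)} (f : Finset (Fin n) → ℝ) {G : ℝ} (hG0 : 0 ≤ G) (hG : ∀ I ⊆ B, |f I| ≤ G) (x : ℕ) :
    |(∑ I ∈ B.powersetCard x, f I) / ((B.card.choose x : ℕ) : ℝ)| ≤ G := by
  rcases Nat.eq_zero_or_pos (B.card.choose x) with h0 | hpos
  · rw [h0, Nat.cast_zero, div_zero, abs_zero]; exact hG0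
  have hpos' : (0 : ℝ) < ((B.card.choose x : ℕ) : ℝ) := by exact_mod_cast hpos
  rw [abs_div, abs_of_pos hpos', div_le_iff₀ hpos']
  calc |∑ I ∈ B.powersetCard x, f I| ≤ ∑ I ∈ B.powersetCard x, |f I| := abs_sum_le_sum_abs _ _
    _ ≤ ∑ _I ∈ B.powersetCard x, G := sum_le_sum fun I hI => hG I (mem_powersetCard.1 hI).1
    _ = G * ((B.card.choose x : ℕ) : ℝ) := by rw [sum_const, card_powersetCard, nsmul_eq_mul, mul_comm]

omit hπ hπ' in
/-- **The symmetrisation of a nonnegative statistic is nonnegative.** [folklore] -/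
theorem symm_nonneg {B : Finset (Fin n)} (f : Finset (Fin n) → ℝ) (h0 : ∀ I ⊆ B, 0 ≤ f I) (x : ℕ) :
    0 ≤ (∑ I ∈ B.powersetCard x, f I) / ((B.card.choose x : ℕ) : ℝ) :=
  div_nonneg (sum_nonneg fun I hI => h0 I (mem_powersetCard.1 hI).1) (Nat.cast_nonneg _)

end Summit.PneNP.PneNP.Theorems.ChebyshevTracialDesignInSetSymmetrization

end
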